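import Literature.Geometry.Riemannian.TwoPointExpInverse
import Literature.Geometry.Riemannian.MaximalGeodesicRescaling
import Literature.Geometry.Lorentzian.GeodesicExtension
import Literature.Geometry.Lorentzian.FutureNullCompleteness
import HarnessLib

/-!
# A forward-complete nonconstant geodesic has no future endpoint

For a `C^∞` covariant derivative `cov` on the tangent bundle of a Hausdorff manifold `M` without
boundary (finite-dimensional complete model space) we prove:

* `not_tendsto_atTop_of_isGeodesicOn` — if `β` is a geodesic of `cov` on an open interval
  `D ⊇ [0, ∞)` with `β' 0 ≠ 0`, then `β t` converges to no point of `M` as `t → +∞`.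

In the language of `Literature.Geometry.Lorentzian.Causality`: an affinely parametrised
nonconstant geodesic which is complete towards the future (`¬ BddAbove` of its domain) is future
endless (`IsFutureEndless` on every final ray of its domain, `hasFutureEndpoint_iff_tendsto_atTop`).
This is the fact tacitly used whenever the non-imprisonment lemma of causality theory (O'Neill
1983, Ch. 14, Lemma 14.13; Hawking–Ellis 1973, Prop. 6.4.7), which is about curves *without
future endpoint*, is applied to a *complete* causal geodesic (e.g. Hawking–Ellis 1973, §8.1–8.2).
The constant geodesics show that `β' 0 ≠ 0` cannot be dropped.

## Proof

Let `z` be a would-be limit and `W ∋ z` a uniformly normal neighbourhood with its two-point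
inverse `Ξ(q, ·) = exp_q⁻¹` and the open set `Src` of small vectors on which
`(q, v) ↦ (q, exp_q v)` is injective (`Literature.Geometry.Riemannian.exists_twoPoint_expInverse`;
Lee 2018, Prop. 5.19 (e); O'Neill 1983, Ch. 5, Lemma 5.5 ff.). From some parameter `t₂` on, `β`
lies in `W`; re-based there (`q = β t₂`, `w = β' t₂ ≠ 0`) the geodesic is `s ↦ exp_q (s w)` for
`s ≥ 0` (Lee, Prop. 5.19 (b): `Literature.Geometry.Riemannian.expMap_smul_of_mem`, after
`subset_maximalGeodesicDomain_of_isGeodesicOn`). The set of `s ≥ 0` up to which `(q, s w) ∈ Src`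
contains `0`, and at its supremum `S` continuity gives `S w = Ξ(q, β (t₂ + S))`, a point of the
open set `Src` — so the set is all of `[0, ∞)` and `s w = Ξ(q, β (t₂ + s))` for every `s ≥ 0`
by injectivity. The right-hand side converges (to `Ξ(q, z)`), the left-hand side is unbounded.

Everything is proved; no definitions and no named facts are introduced.

## References

* J. M. Lee, *Introduction to Riemannian Manifolds*, 2nd ed., GTM 176 (2018), Prop. 5.19 (b), (e).
  Key `LeeRiemannianManifolds2018`.
* B. O'Neill, *Semi-Riemannian geometry with applications to relativity*, Academic Press 1983,
  Ch. 3, p. 68 (maximal geodesics); Ch. 5, Lemma 5.5–Prop. 5.7 (normal neighbourhoods); Ch. 14,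
  Lemma 14.13 (p. 407). Key `ONeillSemiRiemannian1983`.
* S. W. Hawking, G. F. R. Ellis, *The large scale structure of space-time*, CUP 1973, §6.4,
  Prop. 6.4.7; §8.1. Key `HawkingEllis1973CUP`.
-/

noncomputable section

open Bundle Set Filter Function Metric
open scoped Manifold ContDiff Topology

namespace Literature.Geometry.Lorentzian

open Literature.Geometry.Riemannian

variable {E : Type*} [NormedAddCommGroup E] [NormedSpace ℝ E] {H : Type*} [TopologicalSpace H]
  {I : ModelWithCorners ℝ E H} {M : Type*} [TopologicalSpace M] [ChartedSpace H M]
  [IsManifold I ∞ M] [FiniteDimensional ℝ E] [CompleteSpace E] [T2Space M] [I.Boundaryless]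
  {cov : CovariantDerivative I E (TangentSpace I : M → Type _)}
  [CovariantDerivative.ContMDiffCovariantDerivative cov 1]
  [CovariantDerivative.ContMDiffCovariantDerivative cov (⊤ : ℕ∞)]

/-- **A geodesic ray does not converge.** For a `C^∞` connection on a Hausdorff manifold without
boundary, a geodesic `β` on an open interval `D ⊇ [0, ∞)` with nonzero velocity at `0` has no
limit in `M` as the (affine) parameter tends to `+∞`: in other words an affinely parametrised
nonconstant geodesic which is *complete* towards the future has no future endpoint. Proof: near a
would-be limit `z` take a uniformly normal neighbourhood `W ∋ z` with its two-point inverse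
`Ξ(q, ·) = exp_q⁻¹` (`exists_twoPoint_expInverse`; Lee 2018, Prop. 5.19 (e)); from a parameter
on, `β` lies in `W`; based at such a point `q = β t₂` with velocity `w`, `β (t₂ + s) = exp_q (s w)`
(Lee, Prop. 5.19 (b)), and by the injectivity of `(q, v) ↦ (q, exp_q v)` on the small vectors and
a continuity argument, `s w` is the small preimage `Ξ(q, β (t₂ + s))` for *all* `s ≥ 0` — bounded
as `s → ∞` (it converges to `Ξ(q, z)`), whereas `‖s w‖ → ∞`. O'Neill 1983, Ch. 5, Prop. 5.7 and
Ch. 3, p. 68 (a geodesic in a normal neighbourhood is the radial one); Hawking–Ellis 1973, §8.1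
(endpoints of incomplete geodesics). [cite: LeeRiemannianManifolds2018, Prop. 5.19 (b), (e)] -/
theorem not_tendsto_atTop_of_isGeodesicOn {β : ℝ → M} {D : Set ℝ} (hDo : IsOpen D)
    (hDc : D.OrdConnected) (hD : Ici (0 : ℝ) ⊆ D) (hβ : IsGeodesicOn cov β D)
    (hv : velocity I β 0 ≠ 0) (z : M) : ¬ Tendsto β atTop (𝓝 z) := by
  intro hlim
  haveI : BoundarylessManifold I M := inferInstance
  -- Step 1: the uniformly normal neighbourhood of `z`
  obtain ⟨W, Src, Ξ, hWo, hzW, hWch, hSo, hW0, -, hinj, hinv, hΞs, -⟩ :=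
    exists_twoPoint_expInverse (cov := cov) z
  set e := trivializationAt E (TangentSpace I : M → Type _) z with he
  -- Step 2: eventually `β` lies in `W`; re-base at such a parameter `t₂ ≥ 0`
  obtain ⟨t₂, ht₂0, ht₂⟩ : ∃ t₂ : ℝ, 0 ≤ t₂ ∧ ∀ t, t₂ ≤ t → β t ∈ W := by
    have h1 : ∀ᶠ t in atTop, β t ∈ W := hlim.eventually_mem (hWo.mem_nhds hzW)
    obtain ⟨t₂, ht₂⟩ := eventually_atTop.1 (h1.and (eventually_ge_atTop 0))
    exact ⟨max t₂ 0, le_max_right _ _, fun t ht ↦ (ht₂ t ((le_max_left _ _).trans ht)).1⟩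
  have ht₂D : t₂ ∈ D := hD (mem_Ici.2 ht₂0)
  set β₂ : ℝ → M := fun s ↦ β (s - -t₂) with hβ₂
  set D₂ : Set ℝ := (fun s ↦ s - -t₂) ⁻¹' D with hD₂
  have hβ₂geo : IsGeodesicOn cov β₂ D₂ := hβ.comp_sub_const (-t₂)
  have hD₂o : IsOpen D₂ := hDo.preimage (continuous_id.sub continuous_const)
  have hD₂c : D₂.OrdConnected := by
    refine ⟨fun a ha c hc u hu ↦ ?_⟩
    show u - -t₂ ∈ D
    exact hDc.out ha hc ⟨by linarith [hu.1], by linarith [hu.2]⟩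
  have hD₂sub : ∀ s : ℝ, 0 ≤ s → s ∈ D₂ := fun s hs ↦ by
    show s - -t₂ ∈ D
    exact hD (mem_Ici.2 (by linarith))
  have h0D₂ : (0 : ℝ) ∈ D₂ := hD₂sub 0 le_rfl
  set q : M := β t₂ with hq
  have hβ₂0 : β₂ 0 = q := by
    show β (0 - -t₂) = β t₂
    rw [zero_sub, neg_neg]
  set w : TangentSpace I q := velocity I β t₂ with hw
  have hβ₂v : velocity I β₂ 0 = w := by
    rw [hβ₂, velocity_comp_sub_const β (-t₂) 0, zero_sub, neg_neg]
  have hw0 : w ≠ 0 :=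
    hβ.velocity_ne_zero hDo hDc (hD (mem_Ici.2 le_rfl)) hv ht₂D
  -- Step 3: `β (s + t₂) = exp_q (s w)` for `s ≥ 0`
  obtain ⟨hsub, heq⟩ :=
    subset_maximalGeodesicDomain_of_isGeodesicOn hD₂o hD₂c h0D₂ hβ₂geo hβ₂0 hβ₂v
  have hexp : ∀ s : ℝ, 0 ≤ s → s • w ∈ expDomain cov q ∧ expMap cov q (s • w) = β (s + t₂) := by
    intro s hs
    obtain ⟨h1, h2⟩ := expMap_smul_of_mem (cov := cov) q w (hsub (hD₂sub s hs))
    refine ⟨h1, ?_⟩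
    rw [h2, ← heq (hD₂sub s hs)]
    show β (s - -t₂) = β (s + t₂)
    rw [sub_neg_eq_add]
  have hqW : q ∈ W := ht₂ t₂ le_rfl
  have hβW : ∀ s : ℝ, 0 ≤ s → β (s + t₂) ∈ W := fun s hs ↦ ht₂ _ (by linarith)
  have hqb : q ∈ e.baseSet := by
    rw [he, TangentBundle.trivializationAt_baseSet]
    exact hWch hqW
  -- Step 4: the two coordinate descriptions of the ray
  set ξ : ℝ → E := fun s ↦ s • e.continuousLinearMapAt ℝ q w with hξ
  set ζ : ℝ → E := fun s ↦ Ξ q (β (s + t₂)) with hζ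
  have hsymm : ∀ s, e.symmL ℝ q (ξ s) = s • w := by
    intro s
    show e.symmL ℝ q (s • e.continuousLinearMapAt ℝ q w) = s • w
    rw [map_smul, Trivialization.symmL_continuousLinearMapAt _ hqb]
  have hFξ : ∀ s : ℝ, 0 ≤ s → expMap cov q (e.symmL ℝ q (ξ s)) = β (s + t₂) := fun s hs ↦ by
    rw [hsymm]
    exact (hexp s hs).2
  have hFζ : ∀ s : ℝ, 0 ≤ s →
      (q, ζ s) ∈ Src ∧ expMap cov q (e.symmL ℝ q (ζ s)) = β (s + t₂) :=
    fun s hs ↦ hinv q hqW _ (hβW s hs)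
  have hξζ : ∀ s : ℝ, 0 ≤ s → (q, ξ s) ∈ Src → ξ s = ζ s := by
    intro s hs hmem
    have h := hinj hmem (hFζ s hs).1 (by
      show (q, expMap cov q (e.symmL ℝ q (ξ s))) = (q, expMap cov q (e.symmL ℝ q (ζ s)))
      rw [hFξ s hs, (hFζ s hs).2])
    exact (Prod.ext_iff.1 h).2
  -- Step 5: continuity of the two descriptions
  have hξc : Continuous ξ := continuous_id.smul continuous_const
  have hβc : ∀ s : ℝ, 0 ≤ s → ContinuousAt (fun s : ℝ ↦ β (s + t₂)) s := by
    intro s hs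
    have h1 : ContinuousAt β (s + t₂) :=
      (IsGeodesicOn.mdifferentiableAt_holds hβ (hD (mem_Ici.2 (by linarith)))).continuousAt
    have h2 : ContinuousAt (fun s : ℝ ↦ s + t₂) s := (continuous_add_const t₂).continuousAt
    exact ContinuousAt.comp (g := β) (f := fun s : ℝ ↦ s + t₂) h1 h2
  have hΞcont : ∀ y ∈ W, ContinuousAt (Ξ q) y := by
    intro y hy
    have h1 : ContinuousAt (uncurry Ξ) (q, y) :=
      hΞs.continuousOn.continuousAt ((hWo.prod hWo).mem_nhds ⟨hqW, hy⟩)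
    exact h1.comp (continuousAt_const.prodMk continuousAt_id)
  have hζc : ∀ s : ℝ, 0 ≤ s → ContinuousAt ζ s := fun s hs ↦
    ContinuousAt.comp (g := Ξ q) (f := fun s : ℝ ↦ β (s + t₂)) (hΞcont _ (hβW s hs)) (hβc s hs)
  have hopen : ∀ s₀ : ℝ, (q, ξ s₀) ∈ Src → ∃ δ > 0, ∀ s, |s - s₀| < δ → (q, ξ s) ∈ Src := by
    intro s₀ hmem
    have hc : Continuous fun s : ℝ ↦ ((q, ξ s) : M × E) := continuous_const.prodMk hξc
    have h1 : ∀ᶠ s in 𝓝 s₀, (q, ξ s) ∈ Src := hc.continuousAt.eventually_mem (hSo.mem_nhds hmem)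
    obtain ⟨δ, hδ, h⟩ := Metric.eventually_nhds_iff.1 h1
    exact ⟨δ, hδ, fun s hs ↦ h (by rwa [Real.dist_eq])⟩
  -- Step 6: the whole ray is read by small vectors: `(q, ξ s) ∈ Src` for all `s ≥ 0`
  have hall : ∀ s : ℝ, 0 ≤ s → (q, ξ s) ∈ Src := by
    by_contra hcon
    push Not at hcon
    obtain ⟨s₁, hs₁, hs₁mem⟩ := hcon
    set B : Set ℝ := {s | 0 ≤ s ∧ (q, ξ s) ∉ Src} with hB
    have hBne : B.Nonempty := ⟨s₁, hs₁, hs₁mem⟩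
    have hBbdd : BddBelow B := ⟨0, fun s hs ↦ hs.1⟩
    set S := sInf B with hS
    have hlt : ∀ s : ℝ, 0 ≤ s → s < S → (q, ξ s) ∈ Src := fun s hs hsS ↦ by
      by_contra h
      exact (not_lt.2 (csInf_le hBbdd ⟨hs, h⟩)) hsS
    have h0mem : (q, ξ 0) ∈ Src := by
      have : ξ 0 = 0 := zero_smul _ _
      rw [this]
      exact hW0 q hqW
    obtain ⟨δ, hδ, hδmem⟩ := hopen 0 h0mem
    have hδS : δ ≤ S := by
      refine le_csInf hBne fun b hb ↦ ?_
      by_contra h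
      push Not at h
      exact hb.2 (hδmem b (by rw [abs_lt]; constructor <;> linarith [hb.1]))
    have hSpos : 0 < S := lt_of_lt_of_le hδ hδS
    have hξS : ξ S = ζ S := by
      have h1 : Tendsto ξ (𝓝[<] S) (𝓝 (ξ S)) := hξc.continuousAt.continuousWithinAt
      have h2 : Tendsto ζ (𝓝[<] S) (𝓝 (ζ S)) := (hζc S hSpos.le).continuousWithinAt
      have h3 : ξ =ᶠ[𝓝[<] S] ζ := by
        filter_upwards [Ioo_mem_nhdsLT hSpos] with s hs
        exact hξζ s hs.1.le (hlt s hs.1.le hs.2)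
      exact tendsto_nhds_unique (h1.congr' h3) h2
    have hSmem : (q, ξ S) ∈ Src := by
      rw [hξS]
      exact (hFζ S hSpos.le).1
    obtain ⟨δ', hδ', hδ'mem⟩ := hopen S hSmem
    obtain ⟨b, hbB, hbS⟩ := exists_lt_of_csInf_lt hBne (show sInf B < S + δ' by linarith)
    have hSb : S ≤ b := csInf_le hBbdd hbB
    exact hbB.2 (hδ'mem b (by rw [abs_lt]; constructor <;> linarith))
  have heqξζ : ∀ s : ℝ, 0 ≤ s → ξ s = ζ s := fun s hs ↦ hξζ s hs (hall s hs)
  -- Step 7: `ζ` converges, `ξ` is unbounded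
  have hζlim : Tendsto ζ atTop (𝓝 (Ξ q z)) := by
    have hβlim : Tendsto (fun s : ℝ ↦ β (s + t₂)) atTop (𝓝 z) :=
      hlim.comp (tendsto_atTop_add_const_right _ t₂ tendsto_id)
    exact (hΞcont z hzW).tendsto.comp hβlim
  obtain ⟨s₃, hs₃⟩ : ∃ s₃ : ℝ, ∀ s, s₃ ≤ s → dist (ζ s) (Ξ q z) < 1 :=
    eventually_atTop.1 (hζlim.eventually (Metric.ball_mem_nhds _ one_pos))
  have hew : e.continuousLinearMapAt ℝ q w ≠ 0 := by
    intro h0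
    apply hw0
    have := congrArg (e.symmL ℝ q) h0
    rwa [Trivialization.symmL_continuousLinearMapAt _ hqb, map_zero] at this
  have hnorm : 0 < ‖e.continuousLinearMapAt ℝ q w‖ := norm_pos_iff.2 hew
  set A : ℝ := ‖Ξ q z‖ + 1 with hA
  obtain ⟨s, hs0, hs₃', hsbig⟩ : ∃ s : ℝ, 0 ≤ s ∧ s₃ ≤ s ∧ A < s * ‖e.continuousLinearMapAt ℝ q w‖ := by
    refine ⟨max (max 0 s₃) (A / ‖e.continuousLinearMapAt ℝ q w‖ + 1),
      (le_max_left _ _).trans (le_max_left _ _), (le_max_right _ _).trans (le_max_left _ _), ?_⟩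
    have h1 : A / ‖e.continuousLinearMapAt ℝ q w‖ + 1 ≤
        max (max 0 s₃) (A / ‖e.continuousLinearMapAt ℝ q w‖ + 1) := le_max_right _ _
    have h2 : A = A / ‖e.continuousLinearMapAt ℝ q w‖ * ‖e.continuousLinearMapAt ℝ q w‖ := by
      field_simp
    calc A = A / ‖e.continuousLinearMapAt ℝ q w‖ * ‖e.continuousLinearMapAt ℝ q w‖ := h2
      _ < (A / ‖e.continuousLinearMapAt ℝ q w‖ + 1) * ‖e.continuousLinearMapAt ℝ q w‖ := by
          nlinarith
      _ ≤ max (max 0 s₃) (A / ‖e.continuousLinearMapAt ℝ q w‖ + 1) *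
            ‖e.continuousLinearMapAt ℝ q w‖ := by gcongr
  have h1 : ‖ξ s‖ = s * ‖e.continuousLinearMapAt ℝ q w‖ := by
    show ‖s • e.continuousLinearMapAt ℝ q w‖ = s * ‖e.continuousLinearMapAt ℝ q w‖
    rw [norm_smul, Real.norm_eq_abs, abs_of_nonneg hs0]
  have h2 : ‖ζ s‖ < A := by
    have h3 := hs₃ s hs₃'
    rw [dist_eq_norm] at h3
    have h4 : ‖ζ s‖ ≤ ‖ζ s - Ξ q z‖ + ‖Ξ q z‖ := norm_le_norm_sub_add _ _
    rw [hA]; linarith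
  rw [heqξζ s hs0] at h1
  linarith

end Literature.Geometry.Lorentzian

end
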